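import Literature.AnabelianGeometry.SemiGraphs.QuasiTemperoidsThmA4ExistsChart
import HarnessLib

/-!
# Semi-graphs of anabelioids, Appendix: Theorem A.4 — assembly from a GENERAL (model) engine

Mochizuki, *Semi-graphs of anabelioids*, Publ. RIMS **42** (2006), Appendix, Theorem A.4 (manuscript
pp. 82–86) [cite: MochizukiSemiAnbd2006, Thm A.4 pp.82-86].  PROOF-ONLY assembly step, row **A4-∃-ASM**
of `plan/L3/SUBDAG-SemiAnbd-Cor311.md` (holder abc-iut-w5-d129): the companion
`QuasiTemperoidsThmA4ExistsChart.lean` (`ThmA4Chart.thmA4_exists_of_engine`) transports the CHART-ROUTE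
engine — a continuous homomorphism `φ : Π₁ → Π₂` with `F ⋙ ι₁ ≅ ι₂ ⋙ B^temp(φ)`, available only for
second countable `Πᵢ` — along charts `Tᵢ ≌ B^temp(Πᵢ)`; here the SAME transport for a GENERAL engine
(no countability; the shape the Čech route of row A4-∃ produces): for the model quasi-temperoids
`B^temp(Πᵢ)[Aᵢ] = Over' Aᵢ` and every `F : Over' A₂ ⥤ Over' A₁` preserving finite limits, countable
colimits and nondegenerate objects, SOME functor `Ψ : B^temp(Π₂) ⥤ B^temp(Π₁)` preserving finite limits
and countable colimits with `F ⋙ ι₁ ≅ ι₂ ⋙ Ψ`.  GIVEN that engine conclusion as the HYPOTHESIS `hE`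
(spelled out verbatim, no `Prop` definition):

* `ThmA4Chart.thmA4_exists_of_engine'` — the existence half of Thm. A.4 for arbitrary connected
  temperoids (`ψ^* := e₂ ⋙ Ψ ⋙ e₁⁻¹` along the charts, `φ^* ⋙ λ₁^* ≅ λ₂^* ⋙ ψ^*`);
* `ThmA4Chart.thmA4_charts_of_engine'` — with the uniqueness clause (`thmA4_unique`, p414142);
* **`ThmA4Chart.thmA4_of_engine'` : hE → ThmA4** — the typed named fact `ThmA4` (F-1634) REDUCED to the
  model engine; the engine itself is row A4-∃ (Čech route, abc-iut-w4-d110) and is NOT proved here.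

HONEST FRAMING: conditional on `hE`; nothing is rounded up; nothing takes a side on [IUTchIII] Cor. 3.12.
-/

namespace Literature.AnabelianGeometry.SemiGraphs

namespace ThmA4Chart

open CategoryTheory CategoryTheory.Limits Topology
open Literature.AlgebraicGeometry.Frobenioids (IsConnectedObj IsNonemptyObj)

universe v₁ v₂ u u₁ u₂

/-- **Thm. A.4, existence half — ASSEMBLY from a general model engine.** Given the engine conclusion
`hE` (for functors between the model quasi-temperoids `B^temp(Πᵢ)[Aᵢ]`: a finite-limit- and
countable-colimit-preserving `Ψ : B^temp(Π₂) ⥤ B^temp(Π₁)` with `F ⋙ ι₁ ≅ ι₂ ⋙ Ψ`), every morphism of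
connected quasi-temperoids `φ : T₁[A₁] → T₂[A₂]` (`Tᵢ ≌ B^temp(Πᵢ)` charts, `Aᵢ` connected) is the
restriction of a morphism of temperoids `ψ : T₁ → T₂`: `φ^* ⋙ λ₁^* ≅ λ₂^* ⋙ ψ^*`.
[cite: MochizukiSemiAnbd2006, Thm A.4 pp.82-86] -/
theorem thmA4_exists_of_engine'
    (hE : ∀ {G₁ : Type u} [Group G₁] [TopologicalSpace G₁] [IsTopologicalGroup G₁]
      {G₂ : Type u} [Group G₂] [TopologicalSpace G₂] [IsTopologicalGroup G₂]
      (_ : IsTempered G₁) (_ : IsTempered G₂)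
      {A₁ : BTemp G₁} (_ : IsConnectedObj A₁) {A₂ : BTemp G₂} (_ : IsConnectedObj A₂)
      (F : Over' A₂ ⥤ Over' A₁) (_ : PreservesFiniteLimits F)
      (_ : ∀ (J : Type) [SmallCategory J] [CountableCategory J], PreservesColimitsOfShape J F)
      (_ : ∀ X : Over' A₂, IsNondegenerateObj X → IsNondegenerateObj (F.obj X)),
      ∃ Ψ : BTemp G₂ ⥤ BTemp G₁, PreservesFiniteLimits Ψ ∧
        (∀ (J : Type) [SmallCategory J] [CountableCategory J], PreservesColimitsOfShape J Ψ) ∧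
        Nonempty (F ⋙ (admitsHomTo A₁).ι ≅ (admitsHomTo A₂).ι ⋙ Ψ))
    {T₁ : Type u₁} [Category.{v₁} T₁] {T₂ : Type u₂} [Category.{v₂} T₂]
    (c₁ : ConnectedTemperoidChart.{v₁, u, u₁} T₁) (c₂ : ConnectedTemperoidChart.{v₂, u, u₂} T₂)
    {A₁ : T₁} {A₂ : T₂} (hA₁ : IsConnectedObj A₁) (hA₂ : IsConnectedObj A₂)
    (φ : TemperoidHom (Over' A₁) (Over' A₂)) (hφ : φ.PreservesNondegenerate) :
    ∃ ψ : TemperoidHom T₁ T₂,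
      Nonempty (φ.pullback ⋙ (admitsHomTo A₁).ι ≅ (admitsHomTo A₂).ι ⋙ ψ.pullback) := by
  -- charts and base objects
  let e₁ := c₁.equiv
  let e₂ := c₂.equiv
  let B₁ : BTemp c₁.G := e₁.functor.obj A₁
  let B₂ : BTemp c₂.G := e₂.functor.obj A₂
  have hB₁ : IsConnectedObj B₁ := TemperoidTransport.isConnectedObj_functor_obj e₁ hA₁
  have hB₂ : IsConnectedObj B₂ := TemperoidTransport.isConnectedObj_functor_obj e₂ hA₂
  let o₁ : Over' A₁ ≌ Over' B₁ := overPrimeEquivOfEquiv e₁ A₁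
  let o₂ : Over' A₂ ≌ Over' B₂ := overPrimeEquivOfEquiv e₂ A₂
  -- the functor between the model quasi-temperoids
  let F : Over' B₂ ⥤ Over' B₁ := o₂.inverse ⋙ φ.pullback ⋙ o₁.functor
  haveI := φ.preservesFiniteLimits
  have hlim : PreservesFiniteLimits F := by
    haveI : PreservesFiniteLimits (φ.pullback ⋙ o₁.functor) := comp_preservesFiniteLimits _ _
    exact comp_preservesFiniteLimits _ _
  have hcolim : ∀ (J : Type) [SmallCategory J] [CountableCategory J], PreservesColimitsOfShape J F := by
    intro J _ _
    haveI : PreservesColimitsOfShape J φ.pullback := φ.preservesCountableColimits J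
    infer_instance
  have hnd : ∀ X : Over' B₂, IsNondegenerateObj X → IsNondegenerateObj (F.obj X) := fun X hX =>
    isNondegenerateObj_functor_obj o₁ (hφ _ (isNondegenerateObj_functor_obj o₂.symm hX))
  -- the engine
  obtain ⟨Ψ₀, hΨ₀lim, hΨ₀colim, ⟨θ⟩⟩ := hE c₁.isTempered c₂.isTempered hB₁ hB₂ F hlim hcolim hnd
  -- ψ^* := Ψ₀ transported along the charts
  let Ψ : T₂ ⥤ T₁ := e₂.functor ⋙ Ψ₀ ⋙ e₁.inverse
  haveI := hΨ₀lim
  have hΨlim : PreservesFiniteLimits Ψ := by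
    haveI : PreservesFiniteLimits (Ψ₀ ⋙ e₁.inverse) := comp_preservesFiniteLimits _ _
    exact comp_preservesFiniteLimits _ _
  have hΨcolim : ∀ (J : Type) [SmallCategory J] [CountableCategory J], PreservesColimitsOfShape J Ψ := by
    intro J _ _
    haveI : PreservesColimitsOfShape J Ψ₀ := hΨ₀colim J
    infer_instance
  refine ⟨⟨Ψ, hΨlim, hΨcolim⟩, ⟨?_⟩⟩
  -- the 1-commutation: λ₂ ⋙ ψ^* ≅ φ^* ⋙ λ₁
  have i₂ : (admitsHomTo A₂).ι ⋙ e₂.functor ≅ o₂.functor ⋙ (admitsHomTo B₂).ι := Iso.refl _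
  have i₁ : (admitsHomTo A₁).ι ⋙ e₁.functor ≅ o₁.functor ⋙ (admitsHomTo B₁).ι := Iso.refl _
  symm
  calc (admitsHomTo A₂).ι ⋙ Ψ
      ≅ ((admitsHomTo A₂).ι ⋙ e₂.functor) ⋙ Ψ₀ ⋙ e₁.inverse := Iso.refl _
    _ ≅ (o₂.functor ⋙ (admitsHomTo B₂).ι) ⋙ Ψ₀ ⋙ e₁.inverse := Functor.isoWhiskerRight i₂ _
    _ ≅ o₂.functor ⋙ ((admitsHomTo B₂).ι ⋙ Ψ₀) ⋙ e₁.inverse := Iso.refl _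
    _ ≅ o₂.functor ⋙ (F ⋙ (admitsHomTo B₁).ι) ⋙ e₁.inverse :=
        Functor.isoWhiskerLeft o₂.functor (Functor.isoWhiskerRight θ.symm e₁.inverse)
    _ ≅ (o₂.functor ⋙ o₂.inverse) ⋙ φ.pullback ⋙ (o₁.functor ⋙ (admitsHomTo B₁).ι) ⋙ e₁.inverse :=
        Iso.refl _
    _ ≅ 𝟭 _ ⋙ φ.pullback ⋙ (o₁.functor ⋙ (admitsHomTo B₁).ι) ⋙ e₁.inverse :=
        Functor.isoWhiskerRight o₂.unitIso.symm _
    _ ≅ φ.pullback ⋙ ((admitsHomTo A₁).ι ⋙ e₁.functor) ⋙ e₁.inverse :=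
        Functor.isoWhiskerLeft φ.pullback (Functor.isoWhiskerRight i₁.symm e₁.inverse)
    _ ≅ φ.pullback ⋙ (admitsHomTo A₁).ι ⋙ (e₁.functor ⋙ e₁.inverse) := Iso.refl _
    _ ≅ φ.pullback ⋙ (admitsHomTo A₁).ι ⋙ 𝟭 _ :=
        Functor.isoWhiskerLeft φ.pullback (Functor.isoWhiskerLeft _ e₁.unitIso.symm)
    _ ≅ φ.pullback ⋙ (admitsHomTo A₁).ι := Iso.refl _

/-- **Thm. A.4 along given charts, from a general engine** (existence `thmA4_exists_of_engine'`;
uniqueness `thmA4_unique`, p414142): the `ThmA4`-shaped statement for connected temperoids with charts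
`cᵢ`, CONDITIONAL on the engine conclusion `hE`. [cite: MochizukiSemiAnbd2006, Thm A.4 pp.82-86] -/
theorem thmA4_charts_of_engine'
    (hE : ∀ {G₁ : Type u} [Group G₁] [TopologicalSpace G₁] [IsTopologicalGroup G₁]
      {G₂ : Type u} [Group G₂] [TopologicalSpace G₂] [IsTopologicalGroup G₂]
      (_ : IsTempered G₁) (_ : IsTempered G₂)
      {A₁ : BTemp G₁} (_ : IsConnectedObj A₁) {A₂ : BTemp G₂} (_ : IsConnectedObj A₂)
      (F : Over' A₂ ⥤ Over' A₁) (_ : PreservesFiniteLimits F)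
      (_ : ∀ (J : Type) [SmallCategory J] [CountableCategory J], PreservesColimitsOfShape J F)
      (_ : ∀ X : Over' A₂, IsNondegenerateObj X → IsNondegenerateObj (F.obj X)),
      ∃ Ψ : BTemp G₂ ⥤ BTemp G₁, PreservesFiniteLimits Ψ ∧
        (∀ (J : Type) [SmallCategory J] [CountableCategory J], PreservesColimitsOfShape J Ψ) ∧
        Nonempty (F ⋙ (admitsHomTo A₁).ι ≅ (admitsHomTo A₂).ι ⋙ Ψ))
    {T₁ : Type u₁} [Category.{v₁} T₁] {T₂ : Type u₂} [Category.{v₂} T₂]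
    (c₁ : ConnectedTemperoidChart.{v₁, u, u₁} T₁) (c₂ : ConnectedTemperoidChart.{v₂, u, u₂} T₂)
    {A₁ : T₁} {A₂ : T₂} (hA₁ : IsConnectedObj A₁) (hA₂ : IsConnectedObj A₂)
    (φ : TemperoidHom (Over' A₁) (Over' A₂)) (hφ : φ.PreservesNondegenerate) :
    ∃ (ψ : TemperoidHom T₁ T₂)
      (α : φ.pullback ⋙ (admitsHomTo A₁).ι ≅ (admitsHomTo A₂).ι ⋙ ψ.pullback),
      ∀ (ψ' : TemperoidHom T₁ T₂)
        (α' : φ.pullback ⋙ (admitsHomTo A₁).ι ≅ (admitsHomTo A₂).ι ⋙ ψ'.pullback),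
        ∃! β : ψ.pullback ≅ ψ'.pullback, α ≪≫ (admitsHomTo A₂).ι.isoWhiskerLeft β = α' := by
  obtain ⟨ψ, ⟨α⟩⟩ := thmA4_exists_of_engine' hE c₁ c₂ hA₁ hA₂ φ hφ
  exact ⟨ψ, α, fun ψ' α' => thmA4_unique ⟨c₂⟩ hA₂ φ ψ ψ' α α'⟩

/-- **Theorem A.4 (the typed named fact `ThmA4`, FACT-LIST F-1634) REDUCED TO THE MODEL ENGINE**: if,
for all tempered `Π₁, Π₂`, connected `Aᵢ ∈ B^temp(Πᵢ)` and every `F : B^temp(Π₂)[A₂] ⥤ B^temp(Π₁)[A₁]`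
preserving finite limits, countable colimits and nondegenerate objects, some
`Ψ : B^temp(Π₂) ⥤ B^temp(Π₁)` preserving finite limits and countable colimits satisfies
`F ⋙ ι₁ ≅ ι₂ ⋙ Ψ` (row A4-∃, the Čech-nerve extension `X ↦ coeq(F(X×A₂×A₂) ⇉ F(X×A₂))`), then `ThmA4`
holds (charts from `IsConnectedTemperoid`; uniqueness `thmA4_unique`). CONDITIONAL on `hE`; nothing
is rounded up. [cite: MochizukiSemiAnbd2006, Thm A.4 pp.82-86] -/
theorem thmA4_of_engine'
    (hE : ∀ {G₁ : Type u} [Group G₁] [TopologicalSpace G₁] [IsTopologicalGroup G₁]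
      {G₂ : Type u} [Group G₂] [TopologicalSpace G₂] [IsTopologicalGroup G₂]
      (_ : IsTempered G₁) (_ : IsTempered G₂)
      {A₁ : BTemp G₁} (_ : IsConnectedObj A₁) {A₂ : BTemp G₂} (_ : IsConnectedObj A₂)
      (F : Over' A₂ ⥤ Over' A₁) (_ : PreservesFiniteLimits F)
      (_ : ∀ (J : Type) [SmallCategory J] [CountableCategory J], PreservesColimitsOfShape J F)
      (_ : ∀ X : Over' A₂, IsNondegenerateObj X → IsNondegenerateObj (F.obj X)),
      ∃ Ψ : BTemp G₂ ⥤ BTemp G₁, PreservesFiniteLimits Ψ ∧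
        (∀ (J : Type) [SmallCategory J] [CountableCategory J], PreservesColimitsOfShape J Ψ) ∧
        Nonempty (F ⋙ (admitsHomTo A₁).ι ≅ (admitsHomTo A₂).ι ⋙ Ψ)) :
    Literature.AnabelianGeometry.SemiGraphs.ThmA4.{v₁, v₂, u, u₁, u₂} := by
  intro T₁ _ T₂ _ h₁ h₂ A₁ A₂ hA₁ hA₂ φ hφ
  obtain ⟨c₁⟩ := h₁
  obtain ⟨c₂⟩ := h₂
  exact thmA4_charts_of_engine' hE c₁ c₂ hA₁ hA₂ φ hφ

end ThmA4Chart

end Literature.AnabelianGeometry.SemiGraphs
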